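import Mathlib.Analysis.SpecialFunctions.Pow.Real
import HarnessLib

/-!
# Route `UnitScaleTilt`, crux K1 «MinimiserStabilityRegPr» (stmt-QuantumFields-19200), route-R E′ (A′)-on-Σ, P-A2 (β), row «(n3)-comb» —
# (O2) GROUNDWORK, file F-8c-final-1b: THE MEMBER LETTERS OF THE `hMc` KNIT — ONE CLOSED `eC(L, B₁′, …)` AND THE WINDOWS AT IT (pure reals)

«(O2) groundwork — not consumed by any displayed row before the freeze lifts» (★★OWNER `ym3-torus-plan` g29∕g30 RULINGS №20 (2), №22 (c) «(II) GO»).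
Cell `ym3-torus`, D-0154 (3c) R3 twin-width seat `ym-routeR-w1` (gen 10); pen F-8c-final (★routeR-w6 g9 knit ∕ routeR-w1 g10 letters, «GO letters» 2026-08-29 11:59Z,
interface wishes W2–W3).  THEOREMS ONLY (0 `def`, 0 `sorry`); Mathlib-only, INDEPENDENT of file 1a `…CombLevelMassSlotLetters` (so both file without olean lag); `--supports stmt-QuantumFields-19200 --as helper`, count-neutral.
YM₃ on T³ is a ladder rung (R3), not the Clay problem; nothing here claims `hMcomb`, (β), `hPA2`, the stub, the crux, d = 4 or the mass gap.

THE POINT (W2∕W3 of the knit's author).  G3's `hMc` reads `∀ L > 1, ∀ B₁′ > 0, ∃ eC A B B′, … ∀ F (F.L = L) n K e …, 0 < e → e ≤ eC → W ∈ regFibrePr … e … → In19 … (2B₁′e) … → …`,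
so every Greek letter of the cell theorem F-8b-4 v2 (`θ′ θ_g θ₂ ΘM cB1 …`) must be FROZEN at the cap `eC` (the level windows are monotone in `e`), and `eC` itself must make
(i) the tower windows of ✓F-8c-3a∕✓F-8c-3b available (`10⁷·L³·ε₀ ≤ 1` at the lane's radius convention `ε₀ := (12B₁′+1)·e`, `δ := 2B₁′·e ≤ ε₀∕6`), and (ii) F-8b-4's two
smallnesses `exp(θ′ρ³∕(1−ρ⁴))·θ₂·(1 + cB1)·ρ³∕(1−ρ⁴) ≤ ½`, `12·wS·θ₂²·ρ∕(1−ρ) ≤ ½` true AT THE FROZEN LETTERS.  ★ `windows_at_eC` delivers exactly this as ONE `∧`-lemma over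
ONE closed `eC` (= §0 `smallness_at_eC`'s `min`-expression at the member slopes `θ′ = T′·e`, `θ₂ = T₂·e`), for ANY nonnegative weights `wN wS ΘM`
(F-8b-5b's cell weights, `ΘM` read at the `10⁷`-cap so that it does not see `e`) and ANY dimension letter `d` (the member has `d = (F.P K).d`; no numeral of `d` is used):
positivity of `eC`, `0 < ρ < 1` at `ρ = (√L)⁻¹`, nonnegativity of the frozen `θ′ θ_g θ₂ cB1`, the two smallnesses in F-8b-4 v2's LITERAL letters, and for every
`0 < e ≤ eC` the radius rows `10⁷L³((12B₁′+1)e) ≤ 1`, `2B₁′e ≤ ((12B₁′+1)e)∕6`, `0 ≤ 2B₁′e`, `e ≤ (12B₁′+1)e`, `(12B₁′+1)e ≤ ε₀C`, `2B₁′e ≤ δC`.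
HONEST SCOPE.  Pure real bookkeeping (no analysis); the frozen letters are the ones ✓`…SlotLetters` §5 produces (`aC := 2·(2·ε₀C)`, `μC := 9360·L³·δC`); nothing of
F-8b∕F-8c-final is proved here.

References: T. Bałaban, CMP **102** (1985) 277–309 [Balaban1985Variational] ((2) p.278, (14) p.280, (19) p.281: the windows `ε₀`, `δ` and their ratio); CMP **98** (1985) 17–51
[Balaban1985Averaging] ((52)–(54) p.26, Prop. 3 (122)–(126) p.36); CMP **109** (1987) 249–301 [Balaban1987RG1] ((0.4) p.253).
-/

set_option autoImplicit false

noncomputable section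

namespace Summit.QuantumFields.YangMills.Theorems.Prop7CombLevelMassMemberT3Letters

/-! ## §0 The smallness at `eC` (pure-real core, abstract slopes) -/

/-- `x·t ≤ 1∕2` whenever `0 ≤ x`, `t ≤ 1∕(2x + 1)`. [folklore] -/
theorem mul_le_half_of_le_inv {x t : ℝ} (hx : 0 ≤ x) (ht : t ≤ 1 / (2 * x + 1)) : x * t ≤ 1 / 2 := by
  have hd : 0 < 2 * x + 1 := by linarith
  have h1 : x * t ≤ x * (1 / (2 * x + 1)) := mul_le_mul_of_nonneg_left ht hx
  have h2 : x * (1 / (2 * x + 1)) ≤ 1 / 2 := by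
    rw [mul_one_div, div_le_iff₀ hd]
    linarith
  exact h1.trans h2

/-- `x·t² ≤ 1∕2` whenever `0 ≤ x`, `0 ≤ t ≤ 1`, `t ≤ 1∕(2x + 1)`. [folklore] -/
theorem mul_sq_le_half_of_le_inv {x t : ℝ} (hx : 0 ≤ x) (ht0 : 0 ≤ t) (ht1 : t ≤ 1) (ht : t ≤ 1 / (2 * x + 1)) : x * t ^ 2 ≤ 1 / 2 := by
  have h1 : x * t ^ 2 ≤ x * t := by
    have : t ^ 2 ≤ t := by nlinarith
    exact mul_le_mul_of_nonneg_left this hx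
  exact h1.trans (mul_le_half_of_le_inv hx ht)

/-- ★ **THE SMALLNESS AT `eC` (abstract letters).**  Nonnegative reals `Φ Ψ Ψ5` (= `ρ³∕(1−ρ⁴)`, `ρ∕(1−ρ)`, `ρ⁵∕(1−ρ⁵)`), slopes `T′ T₂ ≥ 0` (`θ′ = T′·e`, `θ₂ = T₂·e`),
weights `wN ΘM` and `wS ≥ 0`, a cap `e₁ > 0` (the `10⁷L³ε₀ ≤ 1` window).  With the frozen bounds `E⁺ := exp(T′e₁Φ)`, `θ₂⁺ := T₂e₁`,
`cB1⁺ := √(2(wNΨ + (ΘM + 3wSθ₂⁺²)Ψ5))`, `X := E⁺·T₂·(1 + cB1⁺)·Φ`, `Y := 12wS·T₂²·Ψ` and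
`eC := min e₁ (min 1 (min (1∕(2X+1)) (1∕(2Y+1))))`: `0 < eC`, `eC ≤ e₁`, `eC ≤ 1`, and at EVERY `0 ≤ e ≤ eC` F-8b-4's two smallnesses hold in the letters
`θ′ := T′·e`, `θ₂ := T₂·e`, `cB1 := √(2(wNΨ + (ΘM + 3wS(T₂e)²)Ψ5))`:
`exp(θ′Φ)·θ₂·(1 + cB1)·Φ ≤ ½` and `12wS·θ₂²·Ψ ≤ ½`. [bookkeeping; pattern ✓`Prop7FibreLevelMassT3Letters.theta_smallness`] -/
theorem smallness_at_eC {Φ Ψ Ψ5 T' T₂ wN wS ΘM e₁ : ℝ} (hΦ : 0 ≤ Φ) (hΨ : 0 ≤ Ψ) (hΨ5 : 0 ≤ Ψ5) (hT' : 0 ≤ T') (hT₂ : 0 ≤ T₂)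
    (hwS : 0 ≤ wS) (he₁ : 0 < e₁) :
    let cB1p : ℝ := Real.sqrt (2 * (wN * Ψ + (ΘM + 3 * wS * (T₂ * e₁) ^ 2) * Ψ5))
    let X : ℝ := Real.exp (T' * e₁ * Φ) * T₂ * (1 + cB1p) * Φ
    let Y : ℝ := 12 * wS * T₂ ^ 2 * Ψ
    let eC : ℝ := min e₁ (min 1 (min (1 / (2 * X + 1)) (1 / (2 * Y + 1))))
    0 < eC ∧ eC ≤ e₁ ∧ eC ≤ 1 ∧
      ∀ e : ℝ, 0 ≤ e → e ≤ eC →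
        Real.exp (T' * e * Φ) * (T₂ * e) * (1 + Real.sqrt (2 * (wN * Ψ + (ΘM + 3 * wS * (T₂ * e) ^ 2) * Ψ5))) * Φ ≤ 1 / 2 ∧
        12 * wS * (T₂ * e) ^ 2 * Ψ ≤ 1 / 2 := by
  intro cB1p X Y eC
  have hcB1p : 0 ≤ cB1p := Real.sqrt_nonneg _
  have hX : 0 ≤ X := by positivity
  have hY : 0 ≤ Y := by positivity
  have hXd : 0 < 2 * X + 1 := by linarith
  have hYd : 0 < 2 * Y + 1 := by linarith
  have heC_pos : 0 < eC := lt_min he₁ (lt_min one_pos (lt_min (by positivity) (by positivity)))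
  have heC_e₁ : eC ≤ e₁ := min_le_left _ _
  have heC_1 : eC ≤ 1 := (min_le_right _ _).trans (min_le_left _ _)
  have heC_X : eC ≤ 1 / (2 * X + 1) := ((min_le_right _ _).trans (min_le_right _ _)).trans (min_le_left _ _)
  have heC_Y : eC ≤ 1 / (2 * Y + 1) := ((min_le_right _ _).trans (min_le_right _ _)).trans (min_le_right _ _)
  refine ⟨heC_pos, heC_e₁, heC_1, fun e he0 he => ?_⟩
  have he₁' : e ≤ e₁ := he.trans heC_e₁
  have he1' : e ≤ 1 := he.trans heC_1
  -- the frozen bounds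
  have hexp : Real.exp (T' * e * Φ) ≤ Real.exp (T' * e₁ * Φ) := by
    apply Real.exp_le_exp.mpr
    have := mul_le_mul_of_nonneg_left he₁' hT'
    exact mul_le_mul_of_nonneg_right this hΦ
  have hθ₂ : T₂ * e ≤ T₂ * e₁ := mul_le_mul_of_nonneg_left he₁' hT₂
  have hθ₂0 : 0 ≤ T₂ * e := mul_nonneg hT₂ he0
  have hcB1 : Real.sqrt (2 * (wN * Ψ + (ΘM + 3 * wS * (T₂ * e) ^ 2) * Ψ5)) ≤ cB1p := by
    apply Real.sqrt_le_sqrt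
    have : (T₂ * e) ^ 2 ≤ (T₂ * e₁) ^ 2 := pow_le_pow_left₀ hθ₂0 hθ₂ 2
    nlinarith [mul_le_mul_of_nonneg_right (mul_le_mul_of_nonneg_left this (by positivity : (0 : ℝ) ≤ 3 * wS)) hΨ5]
  refine ⟨?_, ?_⟩
  · -- `exp(θ′Φ)·θ₂·(1+cB1)·Φ ≤ X·e ≤ ½`
    have hstep : Real.exp (T' * e * Φ) * (T₂ * e) * (1 + Real.sqrt (2 * (wN * Ψ + (ΘM + 3 * wS * (T₂ * e) ^ 2) * Ψ5))) * Φ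
        ≤ X * e := by
      have h1 : Real.exp (T' * e * Φ) * (T₂ * e) ≤ Real.exp (T' * e₁ * Φ) * (T₂ * e) :=
        mul_le_mul_of_nonneg_right hexp hθ₂0
      have h2 : (1 : ℝ) + Real.sqrt (2 * (wN * Ψ + (ΘM + 3 * wS * (T₂ * e) ^ 2) * Ψ5)) ≤ 1 + cB1p := by linarith
      have h3 : 0 ≤ (1 : ℝ) + Real.sqrt (2 * (wN * Ψ + (ΘM + 3 * wS * (T₂ * e) ^ 2) * Ψ5)) := by positivity
      have h12 := mul_le_mul h1 h2 h3 (by positivity)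
      have := mul_le_mul_of_nonneg_right h12 hΦ
      refine this.trans (le_of_eq ?_)
      simp only [X]; ring
    exact hstep.trans (mul_le_half_of_le_inv hX (he.trans heC_X))
  · -- `12wS·θ₂²·Ψ = Y·e² ≤ ½`
    have : 12 * wS * (T₂ * e) ^ 2 * Ψ = Y * e ^ 2 := by simp only [Y]; ring
    rw [this]
    exact mul_sq_le_half_of_le_inv hY he0 he1' (he.trans heC_Y)

/-! ## §1 The `T³` numerals at `ρ = (√L)⁻¹` -/

/-- The three kernel sums' letters are nonnegative: `0 ≤ ρ³∕(1−ρ⁴)`, `0 ≤ ρ∕(1−ρ)`, `0 ≤ ρ⁵∕(1−ρ⁵)` (`0 ≤ ρ < 1`). [folklore] -/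
theorem kernel_letters_nonneg {ρ : ℝ} (hρ0 : 0 ≤ ρ) (hρ1 : ρ < 1) :
    0 ≤ ρ ^ 3 / (1 - ρ ^ 4) ∧ 0 ≤ ρ / (1 - ρ) ∧ 0 ≤ ρ ^ 5 / (1 - ρ ^ 5) := by
  have h4 : ρ ^ 4 < 1 := pow_lt_one₀ hρ0 hρ1 (by norm_num)
  have h5 : ρ ^ 5 < 1 := pow_lt_one₀ hρ0 hρ1 (by norm_num)
  exact ⟨div_nonneg (by positivity) (by linarith), div_nonneg hρ0 (by linarith), div_nonneg (by positivity) (by linarith)⟩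

/-! ## §2 The radius convention of the lane -/

/-- **THE RADIUS ROWS AT `0 < e ≤ eC ≤ e₁ = 1∕(10⁷L³(12B₁′+1))`**: the `10⁷` window at `ε₀ := (12B₁′+1)e`, `δ := 2B₁′e ≤ ε₀∕6`, `0 ≤ δ`, `e ≤ ε₀`, and monotonicity to the caps.
[cite: Balaban1985Variational, (14) p.280, (19) p.281] -/
theorem radius_rows {L B₁' e eC : ℝ} (hL : 0 < L) (hB : 0 < B₁') (he : 0 < e) (heC : e ≤ eC) (hcap : eC ≤ 1 / (10 ^ 7 * L ^ 3 * (12 * B₁' + 1))) :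
    10 ^ 7 * L ^ 3 * ((12 * B₁' + 1) * e) ≤ 1 ∧ 2 * B₁' * e ≤ ((12 * B₁' + 1) * e) / 6 ∧ 0 ≤ 2 * B₁' * e ∧ e ≤ (12 * B₁' + 1) * e ∧
      (12 * B₁' + 1) * e ≤ (12 * B₁' + 1) * eC ∧ 2 * B₁' * e ≤ 2 * B₁' * eC := by
  have hD : 0 < 10 ^ 7 * L ^ 3 * (12 * B₁' + 1) := by positivity
  refine ⟨?_, by nlinarith, by positivity, by nlinarith, by nlinarith, by nlinarith⟩
  have h1 : e ≤ 1 / (10 ^ 7 * L ^ 3 * (12 * B₁' + 1)) := heC.trans hcap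
  rw [le_div_iff₀ hD] at h1
  linarith

/-! ## §3 ★ ONE closed `eC` and the windows at it -/

/-- ★ **THE WINDOWS AT `eC` (W2∕W3).**  Letters: `L > 1` (the family's block size, real), `B₁′ > 0` (`In19`'s constant), a dimension letter `d : ℕ` (the member's `(F.P K).d`),
weights `wN ΘM` and `wS ≥ 0`.  With `ρ := (√L)⁻¹`, the member SLOPES `T′ := 210((2d+2)L)(2(8(d+1)(d+4)L²(2(2(12B₁′+1)))))√(2d)` (`θ′ = T′e`) and
`T₂ := 260(9360L³(2B₁′))((2d+2)L)√(2d)` (`θ₂ = T₂e`), the cap `e₁ := 1∕(10⁷L³(12B₁′+1))` and `eC :=` §0 `smallness_at_eC`'s `min`-expression; frozen caps `ε₀C := (12B₁′+1)eC`,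
`δC := 2B₁′eC`, frozen letters `θ′C θgC θ₂C` (= file 1a `…SlotLetters` §5's at `aC := 2(2ε₀C)`, `μC := 9360L³δC`) and `cB1C := √(2(wN·ρ∕(1−ρ) + (ΘM + 3wSθ₂C²)·ρ⁵∕(1−ρ⁵)))`.
CONCLUSION: `0 < eC`; `0 < ρ < 1`; `0 ≤ θ′C, θgC, θ₂C, cB1C`; F-8b-4 v2's `hsmall` and `hsmallS` in its LITERAL letters; and the radius rows at every `0 < e ≤ eC`.
[cite: Balaban1985Variational, (2) p.278, (14) p.280, (19) p.281; Balaban1985Averaging, Prop. 3 (122)–(126) p.36; Balaban1987RG1, (0.4) p.253] -/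
theorem windows_at_eC (d : ℕ) {L B₁' wN wS ΘM : ℝ} (hL : 1 < L) (hB : 0 < B₁') (hwS : 0 ≤ wS) :
    let ρ : ℝ := (Real.sqrt L)⁻¹
    let T' : ℝ := 210 * ((2 * d + 2) * L) * (2 * (8 * ((d : ℝ) + 1) * ((d : ℝ) + 4) * L ^ 2 * (2 * (2 * (12 * B₁' + 1))))) * Real.sqrt (2 * d)
    let T₂ : ℝ := 260 * (9360 * L ^ 3 * (2 * B₁')) * ((2 * d + 2) * L) * Real.sqrt (2 * d)
    let e₁ : ℝ := 1 / (10 ^ 7 * L ^ 3 * (12 * B₁' + 1))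
    let cB1p : ℝ := Real.sqrt (2 * (wN * (ρ / (1 - ρ)) + (ΘM + 3 * wS * (T₂ * e₁) ^ 2) * (ρ ^ 5 / (1 - ρ ^ 5))))
    let X : ℝ := Real.exp (T' * e₁ * (ρ ^ 3 / (1 - ρ ^ 4))) * T₂ * (1 + cB1p) * (ρ ^ 3 / (1 - ρ ^ 4))
    let Y : ℝ := 12 * wS * T₂ ^ 2 * (ρ / (1 - ρ))
    let eC : ℝ := min e₁ (min 1 (min (1 / (2 * X + 1)) (1 / (2 * Y + 1))))
    let ε₀C : ℝ := (12 * B₁' + 1) * eC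
    let δC : ℝ := 2 * B₁' * eC
    let θ'C : ℝ := 210 * ((2 * d + 2) * L) * (2 * (8 * ((d : ℝ) + 1) * ((d : ℝ) + 4) * L ^ 2 * (2 * (2 * ε₀C)))) * Real.sqrt (2 * d)
    let θgC : ℝ := (24 * (2 * (8 * ((d : ℝ) + 1) * ((d : ℝ) + 4) * L ^ 2 * (2 * (2 * ε₀C)))) + 8 * (((d : ℝ) + 2) * L) ^ 2 * (2 * (2 * ε₀C)))
          * Real.sqrt (d * (L ^ 2 * (L ^ d)⁻¹))
        + 210 * ((2 * d + 2) * L) * (2 * (8 * ((d : ℝ) + 1) * ((d : ℝ) + 4) * L ^ 2 * (2 * (2 * ε₀C)))) * Real.sqrt (8 * (d : ℝ) ^ 2)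
    let θ₂C : ℝ := 260 * (9360 * L ^ 3 * δC) * ((2 * d + 2) * L) * Real.sqrt (2 * d)
    let cB1C : ℝ := Real.sqrt (2 * (wN * (ρ / (1 - ρ)) + (ΘM + 3 * wS * θ₂C ^ 2) * (ρ ^ 5 / (1 - ρ ^ 5))))
    0 < eC ∧ (0 < ρ ∧ ρ < 1) ∧ (0 ≤ θ'C ∧ 0 ≤ θgC ∧ 0 ≤ θ₂C ∧ 0 ≤ cB1C) ∧
      Real.exp (θ'C * (ρ ^ 3 / (1 - ρ ^ 4))) * θ₂C * (1 + cB1C) * (ρ ^ 3 / (1 - ρ ^ 4)) ≤ 1 / 2 ∧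
      12 * wS * θ₂C ^ 2 * (ρ / (1 - ρ)) ≤ 1 / 2 ∧
      ∀ e : ℝ, 0 < e → e ≤ eC →
        10 ^ 7 * L ^ 3 * ((12 * B₁' + 1) * e) ≤ 1 ∧ 2 * B₁' * e ≤ ((12 * B₁' + 1) * e) / 6 ∧ 0 ≤ 2 * B₁' * e ∧ e ≤ (12 * B₁' + 1) * e ∧
          (12 * B₁' + 1) * e ≤ ε₀C ∧ 2 * B₁' * e ≤ δC := by
  intro ρ T' T₂ e₁ cB1p X Y eC ε₀C δC θ'C θgC θ₂C cB1C
  have hL0 : 0 < L := by linarith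
  -- `0 < ρ < 1` (= ✓`Prop7CornerCombCellTheorem.rho_pos_lt_one_T3`, two lines inlined to keep this file Mathlib-only)
  have hs1 : 1 < Real.sqrt L := by have := Real.sqrt_lt_sqrt (by norm_num) hL; rwa [Real.sqrt_one] at this
  have hρ0 : 0 < (Real.sqrt L)⁻¹ := inv_pos.mpr (by linarith)
  have hρ1 : (Real.sqrt L)⁻¹ < 1 := inv_lt_one_of_one_lt₀ hs1
  obtain ⟨hΦ, hΨ, hΨ5⟩ := kernel_letters_nonneg hρ0.le hρ1
  have hT' : 0 ≤ T' := by positivity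
  have hT₂ : 0 ≤ T₂ := by positivity
  have he₁ : 0 < e₁ := by positivity
  -- the abstract smallness at the member slopes
  have hS := smallness_at_eC (wN := wN) (ΘM := ΘM) hΦ hΨ hΨ5 hT' hT₂ hwS he₁
  obtain ⟨heC, heC₁, -, hsm⟩ := hS
  have heC0 : 0 ≤ eC := heC.le
  obtain ⟨hsmall, hsmallS⟩ := hsm eC heC0 le_rfl
  -- the frozen letters are the slopes at `eC`
  have hθ' : θ'C = T' * eC := by simp only [θ'C, T', ε₀C]; ring
  have hθ₂ : θ₂C = T₂ * eC := by simp only [θ₂C, T₂, δC]; ring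
  have hε₀C : 0 ≤ ε₀C := by positivity
  have hδC : 0 ≤ δC := by positivity
  refine ⟨heC, ⟨hρ0, hρ1⟩, ⟨by positivity, by positivity, by positivity, Real.sqrt_nonneg _⟩, ?_, ?_, fun e he heE => ?_⟩
  · rw [hθ', hθ₂]
    simpa only [cB1C, hθ₂, mul_assoc] using hsmall
  · rw [hθ₂]; exact hsmallS
  · exact radius_rows hL0 hB he heE heC₁

end Summit.QuantumFields.YangMills.Theorems.Prop7CombLevelMassMemberT3Letters

end
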